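import Summits.CriticalPhenomena.PercolationContinuityZ3.Theorems.PercNearOneGluingNoHeavyLowerTailCILRelayNeighboursHolds
import HarnessLib

/-!
# `NoHeavyLowerTail` (stmt-CriticalPhenomena-4575) — hull-port line: integrating the port coins against an ARBITRARY
# witness vertex

Support file (prover `prim-hp-1`, hull-port / coupling line; `--supports stmt-CriticalPhenomena-4575`).  No definitions,
no named facts, no sorries.

`HullPort.portComparison_vertex` is `CutObserver.portComparison_of_separation` (prover `prim-gen-induct`) with the witness port
`p i` replaced by an arbitrary vertex `b`: if `μ{M_l ≤ j} ≤ μ{M_b ≤ j}` in `H`-reachability (`H` = no pair at the observer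
`o`), then for every finite set `Q` of port indices and every finite vertex set `S`
`μ({∀ m ∈ Q, p m ~' b → o–p m closed} ∩ {∀ v ∈ S, v ≁' b} ∩ {M_l ≤ j}) ≤ μ(… ∩ {M_b ≤ j})`.
Induction on `Q` (each coin peeled gives a convex combination of the statements for `Q ∖ m₀` with `S` and `S ∪ {p m₀}`);
the base `Q = ∅` is separation stability (†) `CutObserver.separation_stable` transferred to the configuration without the
pairs at `o` (`CutObserver.measureReal_preimage_avoid`).  This is "Lemma A" of the hull-port memo (crux evidence
HULLPORT-COUPLING.md): raising the weights of pairs at a dominated vertex keeps it dominated.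
[cite: VandenbergHaggstromKahn2005, Thm. 1.5 — the only probabilistic input, inside `separation_stable`]
-/

noncomputable section

namespace Summit.CriticalPhenomena.PercolationContinuityZ3.Theorems

open MeasureTheory Set Literature.Probability.LatticeModels Literature.Probability.Percolation
open scoped Classical BigOperators

variable {n : ℕ}

namespace HullPort

open CutObserver

/-- **Coin integration against an arbitrary witness.**  Ports `p` (injective), observer `o`, `H`-reachability `~'`
(no pair at `o`), `M_l`/`M_b` = relays `~'`-joined to `p l`/`b`, `b ≠ p l`.  If `μ{M_l ≤ j} ≤ μ{M_b ≤ j}` then for every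
finite `Q` (port indices) and `S` (vertices):
`μ({∀ m ∈ Q, p m ~' b → o–p m closed} ∩ {∀ v ∈ S, v ≁' b} ∩ {M_l ≤ j}) ≤ μ(… ∩ {M_b ≤ j})`. [folklore] -/
theorem portComparison_vertex (w : Sym2 (Fin n) → unitInterval) (A : Finset (Fin n)) (o : Fin n) (j : ℕ)
    {d : ℕ} (p : Fin d → Fin n) (hp : Function.Injective p) (b : Fin n) {l : Fin d} (hbl : b ≠ p l)
    (hs : (prodBernoulli w).real {ω : BondConfig (Fin n) |
        (A.filter fun x => (openGraph (ω ∩ {e | o ∉ e})).Reachable (p l) x).card ≤ j} ≤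
      (prodBernoulli w).real {ω : BondConfig (Fin n) |
        (A.filter fun x => (openGraph (ω ∩ {e | o ∉ e})).Reachable b x).card ≤ j})
    (Q : Finset (Fin d)) (S : Finset (Fin n)) :
    (prodBernoulli w).real
        ({ω : BondConfig (Fin n) | ∀ m ∈ Q, (openGraph (ω ∩ {e | o ∉ e})).Reachable (p m) b → s(o, p m) ∉ ω} ∩
          {ω | ∀ v ∈ S, ¬ (openGraph (ω ∩ {e | o ∉ e})).Reachable v b} ∩
          {ω | (A.filter fun x => (openGraph (ω ∩ {e | o ∉ e})).Reachable (p l) x).card ≤ j}) ≤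
      (prodBernoulli w).real
        ({ω : BondConfig (Fin n) | ∀ m ∈ Q, (openGraph (ω ∩ {e | o ∉ e})).Reachable (p m) b → s(o, p m) ∉ ω} ∩
          {ω | ∀ v ∈ S, ¬ (openGraph (ω ∩ {e | o ∉ e})).Reachable v b} ∩
          {ω | (A.filter fun x => (openGraph (ω ∩ {e | o ∉ e})).Reachable b x).card ≤ j}) := by
  haveI : IsProbabilityMeasure (prodBernoulli w) := inferInstance
  set R : BondConfig (Fin n) → Fin n → Fin n → Prop := fun ω u v =>
    (openGraph (ω ∩ {e | o ∉ e})).Reachable u v with hR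
  -- the two lightness predicates, read on the configuration off `o`
  set PL : BondConfig (Fin n) → Prop := fun ξ =>
    (A.filter fun y => (openGraph ξ).Reachable (p l) y).card ≤ j with hPL
  set PB : BondConfig (Fin n) → Prop := fun ξ =>
    (A.filter fun y => (openGraph ξ).Reachable b y).card ≤ j with hPB
  have eL : {ω : BondConfig (Fin n) | (A.filter fun x => (openGraph (ω ∩ {e | o ∉ e})).Reachable (p l) x).card ≤ j} =
      {ω | PL (ω ∩ {e | o ∉ e})} := by ext ω; simp only [hPL, mem_setOf_eq]
  have eB : {ω : BondConfig (Fin n) | (A.filter fun x => (openGraph (ω ∩ {e | o ∉ e})).Reachable b x).card ≤ j} =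
      {ω | PB (ω ∩ {e | o ∉ e})} := by ext ω; simp only [hPB, mem_setOf_eq]
  rw [eL, eB]
  rw [eL, eB] at hs
  induction Q using Finset.induction_on generalizing S with
  | empty =>
    -- base: separation stability in the graph without the edges at `o`
    set u : Sym2 (Fin n) → unitInterval := fun e => if e ∈ {e : Sym2 (Fin n) | o ∉ e} then w e else 0 with hu
    have key := separation_stable u A hbl S j ?_
    · have e1 : ∀ P : BondConfig (Fin n) → Prop,
          {ω : BondConfig (Fin n) | ∀ m ∈ (∅ : Finset (Fin d)), R ω (p m) b → s(o, p m) ∉ ω} ∩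
            {ω | ∀ v ∈ S, ¬ R ω v b} ∩ {ω | P (ω ∩ {e | o ∉ e})} =
          {ω : BondConfig (Fin n) | ω ∩ {e | o ∉ e} ∈
            ({ξ : BondConfig (Fin n) | ∀ m ∈ S, ¬ (openGraph ξ).Reachable b m} ∩ {ξ | P ξ})} := by
        intro P
        ext ω
        simp only [hR, Finset.notMem_empty, false_imp_iff, implies_true, setOf_true, univ_inter,
          mem_inter_iff, mem_setOf_eq]
        constructor
        · rintro ⟨h1, h2⟩; exact ⟨fun m hm hr => h1 m hm hr.symm, h2⟩
        · rintro ⟨h1, h2⟩; exact ⟨fun v hv hr => h1 v hv hr.symm, h2⟩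
      have k1 := e1 PL
      have k2 := e1 PB
      simp only [hR] at k1 k2
      rw [k1, k2, measureReal_preimage_avoid, measureReal_preimage_avoid]
      exact key
    · have e2 : ∀ P : BondConfig (Fin n) → Prop, {ω : BondConfig (Fin n) | P (ω ∩ {e | o ∉ e})} =
          {ω : BondConfig (Fin n) | ω ∩ {e | o ∉ e} ∈ {ξ : BondConfig (Fin n) | P ξ}} := by
        intro P; ext ω; simp only [mem_setOf_eq]
      have h := hs
      rw [e2 PL, e2 PB, measureReal_preimage_avoid, measureReal_preimage_avoid] at h
      exact h
  | insert m₀ Q hm₀ ih =>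
    -- peel the coin of port m₀
    set c : ℝ := (w s(o, p m₀) : ℝ) with hc
    have hc0 : 0 ≤ c := (w s(o, p m₀)).2.1
    have hc1 : c ≤ 1 := (w s(o, p m₀)).2.2
    -- the decomposition, for a generic H-event
    have decomp : ∀ P : BondConfig (Fin n) → Prop, ∀ S' : Finset (Fin n),
        (prodBernoulli w).real
          ({ω : BondConfig (Fin n) | ∀ m ∈ insert m₀ Q, R ω (p m) b → s(o, p m) ∉ ω} ∩
            {ω | ∀ v ∈ S', ¬ R ω v b} ∩ {ω | P (ω ∩ {e | o ∉ e})}) =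
        c * (prodBernoulli w).real
          ({ω : BondConfig (Fin n) | ∀ m ∈ Q, R ω (p m) b → s(o, p m) ∉ ω} ∩
            {ω | ∀ v ∈ insert (p m₀) S', ¬ R ω v b} ∩ {ω | P (ω ∩ {e | o ∉ e})}) +
        (1 - c) * (prodBernoulli w).real
          ({ω : BondConfig (Fin n) | ∀ m ∈ Q, R ω (p m) b → s(o, p m) ∉ ω} ∩
            {ω | ∀ v ∈ S', ¬ R ω v b} ∩ {ω | P (ω ∩ {e | o ∉ e})}) := by
      intro P S'
      set EQ := {ω : BondConfig (Fin n) | ∀ m ∈ Q, R ω (p m) b → s(o, p m) ∉ ω} with hEQ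
      set F := {ω : BondConfig (Fin n) | ∀ v ∈ S', ¬ R ω v b} ∩ {ω | P (ω ∩ {e | o ∉ e})} with hF
      set R0 := {ω : BondConfig (Fin n) | R ω (p m₀) b} with hR0
      set C0 := {ω : BondConfig (Fin n) | s(o, p m₀) ∉ ω} with hC0
      -- set identities
      have hsplit : {ω : BondConfig (Fin n) | ∀ m ∈ insert m₀ Q, R ω (p m) b → s(o, p m) ∉ ω} ∩
          {ω | ∀ v ∈ S', ¬ R ω v b} ∩ {ω | P (ω ∩ {e | o ∉ e})} =
          (EQ ∩ F ∩ R0ᶜ) ∪ (C0 ∩ (EQ ∩ F ∩ R0)) := by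
        ext ω
        simp only [hEQ, hF, hR0, hC0, Finset.forall_mem_insert, mem_inter_iff, mem_union, mem_setOf_eq,
          mem_compl_iff]
        constructor
        · rintro ⟨⟨⟨h0, hQ⟩, hS⟩, hMx⟩
          by_cases hr : R ω (p m₀) b
          · exact Or.inr ⟨h0 hr, ⟨hQ, hS, hMx⟩, hr⟩
          · exact Or.inl ⟨⟨hQ, hS, hMx⟩, hr⟩
        · rintro (⟨⟨hQ, hS, hMx⟩, hr⟩ | ⟨h0, ⟨hQ, hS, hMx⟩, hr⟩)
          · exact ⟨⟨⟨fun h => absurd h hr, hQ⟩, hS⟩, hMx⟩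
          · exact ⟨⟨⟨fun _ => h0, hQ⟩, hS⟩, hMx⟩
      have hdisj : Disjoint (EQ ∩ F ∩ R0ᶜ) (C0 ∩ (EQ ∩ F ∩ R0)) := by
        rw [Set.disjoint_left]; rintro ω ⟨_, hr⟩ ⟨_, _, hr'⟩; exact hr hr'
      have hinsert : EQ ∩ {ω : BondConfig (Fin n) | ∀ v ∈ insert (p m₀) S', ¬ R ω v b} ∩
          {ω | P (ω ∩ {e | o ∉ e})} = EQ ∩ F ∩ R0ᶜ := by
        ext ω
        simp only [hEQ, hF, hR0, Finset.forall_mem_insert, mem_inter_iff, mem_setOf_eq, mem_compl_iff]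
        tauto
      have hplain : EQ ∩ {ω : BondConfig (Fin n) | ∀ v ∈ S', ¬ R ω v b} ∩ {ω | P (ω ∩ {e | o ∉ e})} =
          EQ ∩ F := by
        rw [hF, inter_assoc]
      -- independence of the coin at m₀ from EQ ∩ F ∩ R0
      set Eo : Finset (Sym2 (Fin n)) := Finset.univ.filter fun e : Sym2 (Fin n) => o ∉ e with hEo
      have hcoe : (↑Eo : Set (Sym2 (Fin n))) = {e | o ∉ e} := coe_edgesAvoiding o
      set Supp : Finset (Sym2 (Fin n)) := Eo ∪ Q.image (fun m => s(o, p m)) with hSupp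
      have hdj : Disjoint ({s(o, p m₀)} : Finset (Sym2 (Fin n))) Supp := by
        rw [Finset.disjoint_singleton_left, hSupp, Finset.mem_union, not_or]
        constructor
        · rw [hEo, Finset.mem_filter]; exact fun h => h.2 (Sym2.mem_mk_left _ _)
        · rw [Finset.mem_image]; rintro ⟨m, hm, heq⟩
          have : m = m₀ := hp (Sym2.congr_right.1 heq)
          exact hm₀ (this ▸ hm)
      have hdet : DeterminedBy (EQ ∩ F ∩ R0) (↑Supp : Set (Sym2 (Fin n))) := by
        rw [determinedBy_iff]
        intro ω ω' h
        have hH : ω ∩ {e | o ∉ e} = ω' ∩ {e | o ∉ e} := by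
          rw [← hcoe]
          ext f
          have := Set.ext_iff.1 h f
          simp only [hSupp, Finset.coe_union, mem_inter_iff, mem_union, Finset.mem_coe] at this ⊢
          constructor
          · rintro ⟨hf, hfE⟩; exact ⟨(this.1 ⟨hf, Or.inl hfE⟩).1, hfE⟩
          · rintro ⟨hf, hfE⟩; exact ⟨(this.2 ⟨hf, Or.inl hfE⟩).1, hfE⟩
        have hQc : ∀ m ∈ Q, (s(o, p m) ∈ ω ↔ s(o, p m) ∈ ω') := by
          intro m hm
          have hmem : s(o, p m) ∈ (↑Supp : Set (Sym2 (Fin n))) := by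
            rw [Finset.mem_coe, hSupp, Finset.mem_union, Finset.mem_image]
            exact Or.inr ⟨m, hm, rfl⟩
          have := Set.ext_iff.1 h (s(o, p m))
          simp only [mem_inter_iff, hmem, and_true] at this
          exact this
        simp only [hEQ, hF, hR0, hR, mem_inter_iff, mem_setOf_eq]
        rw [hH]
        constructor
        · rintro ⟨⟨h1, h2⟩, h3⟩; exact ⟨⟨fun m hm hr => (hQc m hm).not.1 (h1 m hm hr), h2⟩, h3⟩
        · rintro ⟨⟨h1, h2⟩, h3⟩; exact ⟨⟨fun m hm hr => (hQc m hm).not.2 (h1 m hm hr), h2⟩, h3⟩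
      have hind : (prodBernoulli w).real (C0 ∩ (EQ ∩ F ∩ R0)) =
          (1 - c) * (prodBernoulli w).real (EQ ∩ F ∩ R0) := by
        rw [prodBernoulli_real_inter_of_determinedBy_disjoint w hdj (determinedBy_closed (s(o, p m₀))) hdet
          MeasurableSet.of_discrete MeasurableSet.of_discrete, measureReal_closed]
      have hR0split := measureReal_inter_add_sdiff (μ := prodBernoulli w) (s := EQ ∩ F)
        (MeasurableSet.of_discrete (s := R0)) (measure_ne_top _ _)
      have hdiffR : (EQ ∩ F) \ R0 = EQ ∩ F ∩ R0ᶜ := by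
        ext ω; simp only [mem_sdiff, mem_inter_iff, mem_compl_iff]
      rw [hdiffR] at hR0split
      rw [hsplit, measureReal_union hdisj MeasurableSet.of_discrete, hind, hinsert, hplain, ← hR0split]
      ring
    rw [decomp PL S, decomp PB S]
    have h1 := ih (insert (p m₀) S)
    have h2 := ih S
    have h1c := mul_le_mul_of_nonneg_left h1 hc0
    have h2c := mul_le_mul_of_nonneg_left h2 (by linarith : (0 : ℝ) ≤ 1 - c)
    linarith

end HullPort

end Summit.CriticalPhenomena.PercolationContinuityZ3.Theorems

end
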